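import Summits.BirchSwinnertonDyer.BirchSwinnertonDyer.Theorems.ByReductionTypeAtTwoSupersingularColemanClassKit
import HarnessLib

/-!
# Route `ByReductionTypeAtTwo` (rung K4), crux `SupersingularRankZeroAtTwo` (item stmt-BirchSwinnertonDyer-19097),
# UNIT-ANCHOR sub-row: the UNIT-ZONE ANCHORS (part A: ua19a1, ua27a1, ua35a1, ua51a1, ua267a1, ua555a1, ua627a1) — kernel-decided data of the small-conductor curves `A` that the
# unit-anchor transport road pairs with X5 good-supersingular `a₂ = 0` classes (seat `bsd-2adic-ss-1x` GEN 4; census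
# UNIT-ANCHOR-CENSUS-v1, kit j287435; Tschirnhaus data kit j287765)

HONEST FRAMING (cell `bsd-2adic`, run/shared/lean/pub/bsd-2adic/, HUMAN RULINGS D-0036/D-0054/D-0074): THEOREMS ONLY — no
definition, no named fact, no instance, no `sorry`; closes nothing; nothing booked; BSD is NOT proved by any of this.
PARTITION (D-0054): X5@2 good-SUPERSINGULAR, `a₂ = 0` UNIT-ANCHOR sub-row (17/208 rank-`0` classes) × `p = 2` —
types-the-object-of (the anchor side of the road `SSUnitAnchor.bsdp_two_of_unitAnchor`, p558810); bears_on: K4-leaf 19097.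

Per anchor `A = M ⊗ ℚ` (Cremona's minimal model `M = [a₁,a₂,a₃,a₄,a₆]` of a rank-`0` curve of conductor `< 5·10⁵` whose
`2`-division field is that of a target class and which lies in the DOUBLE UNIT ZONE `2 ∤ ∏c_p · #Ш_an`, `#tors` odd — UNIT-ANCHOR-CENSUS-v1):
`Δ`, `c₄`, `b₂,b₄,b₆` (`decide`), `Δ ≠ 0`, global minimality (Silverman's criterion at the primes of `gcd(Δ, c₄)`, or `gcd = 1`),
`#Ã(𝔽₂) = 3` hence good SUPERSINGULAR reduction at `2` with `a₂(A) = 0`. NOT kernel-decided (displayed as CERT hypotheses in the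
class files): `L(A,1) ≠ 0` (Cremona rank `0`), `2 ∤ ∏c_p(A)` (Tate's algorithm, Cremona), `2 ∤ #Ш(A)` (`#Ш_an` odd and, independently
of BSD, PARI `ellrank(A) = [0, 0, 0, []]`: 2-Selmer rank `0`, so `Ш(A)[2] = 0`). No CM statement is made or needed.

References: [CremonaAlgorithms1997] Table 1; [SilvermanAEC2009] III.1, V.2, VII.1 Rem. 1.1, VII.5 Prop. 5.1; UNIT-ANCHOR-CENSUS-v1.md
(run/shared/lean/pub/bsd-2adic/ss1x/gen4/); kit jobs j287435 (census), j287765 (Tschirnhaus).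
-/

set_option autoImplicit false
-- the Theorems namespace of this sub repeats the summit name by design (D-0017 nested layout)
set_option linter.dupNamespace false

noncomputable section

open scoped Classical

open WeierstrassCurve Literature.NumberTheory.EllipticCurves
  Literature.NumberTheory.EllipticCurves.Rank1Residual Literature.NumberTheory.EllipticCurves.Rank1Residual.Typed
  Summit.BirchSwinnertonDyer.Rank1Residual Summit.BirchSwinnertonDyer.Rank1Residual.Supersingular
  Summit.BirchSwinnertonDyer.Rank1Residual.X5 Summit.BirchSwinnertonDyer.Rank1Residual.X5.O1
  Summit.BirchSwinnertonDyer.Rank1Residual.X5.Instances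

namespace Summit.BirchSwinnertonDyer.BirchSwinnertonDyer.Theorems
namespace SSUnitAnchor

/-! ### The anchor `ua19a1` = Cremona `19a1` = `[0, 1, 1, -9, -15]` (`N = 19`; Cremona: rank `0`, `#tors = 3`, `∏c_p = 3`, `#Ш_an = 1` — double unit zone) -/

/-- `Δ = -6859` for the anchor model `[0, 1, 1, -9, -15]`. [cite: CremonaAlgorithms1997, Table 1] -/
theorem ua19a1_Δ : (⟨0, 1, 1, -9, -15⟩ : WeierstrassCurve ℤ).Δ = -6859 := by
  decide

/-- `c₄ = 448` for the anchor model `[0, 1, 1, -9, -15]`. [cite: CremonaAlgorithms1997, Table 1] -/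
theorem ua19a1_c₄ : (⟨0, 1, 1, -9, -15⟩ : WeierstrassCurve ℤ).c₄ = 448 := by
  decide

/-- `b₂, b₄, b₆` of the anchor model `[0, 1, 1, -9, -15]`. [cite: SilvermanAEC2009, III.1] -/
theorem ua19a1_b : (⟨0, 1, 1, -9, -15⟩ : WeierstrassCurve ℤ).b₂ = 4 ∧ (⟨0, 1, 1, -9, -15⟩ : WeierstrassCurve ℤ).b₄ = -18 ∧ (⟨0, 1, 1, -9, -15⟩ : WeierstrassCurve ℤ).b₆ = -59 := by
  decide

/-- The anchor `[0, 1, 1, -9, -15]` is an elliptic curve (`Δ ≠ 0`). [cite: CremonaAlgorithms1997, Table 1] -/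
theorem isElliptic_ua19a1 : ((⟨0, 1, 1, -9, -15⟩ : WeierstrassCurve ℤ).baseChange ℚ).IsElliptic := by
  rw [WeierstrassCurve.isElliptic_iff, baseChange_int_Δ, ua19a1_Δ]; norm_num

/-- The anchor model `[0, 1, 1, -9, -15]` is globally minimal: `gcd(Δ, c₄) = 1`.
[cite: SilvermanAEC2009, VII.1 Remark 1.1] -/
theorem isGloballyMinimal_ua19a1 : ((⟨0, 1, 1, -9, -15⟩ : WeierstrassCurve ℤ).baseChange ℚ).IsGloballyMinimal := by
  exact Instances.isGloballyMinimal_baseChange_int_of_gcd_eq_one (0) (1) (1) (-9) (-15)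
    (by decide)

/-- `#Ã(𝔽₂) = 3` for the anchor `[0, 1, 1, -9, -15]` (`a₁ = 0`, `a₃ = 1`). [cite: SilvermanAEC2009, V.2 and App. A Prop. 1.1 (c)] -/
theorem card_F2_ua19a1 :
    Nat.card ((⟨0, 1, 1, -9, -15⟩ : WeierstrassCurve ℤ).map (Int.castRingHom (ZMod 2))).toAffine.Point = 3 := by
  rw [natCard_point_F2_of_a₁_eq_zero_of_a₃_eq_one _ (by decide) (by decide)]
  decide

/-- **The anchor `[0, 1, 1, -9, -15]` is good SUPERSINGULAR at `2` with `a₂ = 0`** (`2 ∤ Δ`, `#Ã(𝔽₂) = 3`).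
[cite: SilvermanAEC2009, VII.5 Prop. 5.1(a) and V.2] -/
theorem goodSS_two_ua19a1 [((⟨0, 1, 1, -9, -15⟩ : WeierstrassCurve ℤ).baseChange ℚ).IsGloballyMinimal] :
    ((⟨0, 1, 1, -9, -15⟩ : WeierstrassCurve ℤ).baseChange ℚ).HasGoodReductionAtPrime 2 ∧ ((⟨0, 1, 1, -9, -15⟩ : WeierstrassCurve ℤ).baseChange ℚ).frobeniusTrace 2 = 0 ∧
      GoodSS ((⟨0, 1, 1, -9, -15⟩ : WeierstrassCurve ℤ).baseChange ℚ) 2 :=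
  SSColemanRoad.goodSS_two_baseChange_int_of_card_three _ (by rw [ua19a1_Δ]; decide) card_F2_ua19a1

/-! ### The anchor `ua27a1` = Cremona `27a1` = `[0, 0, 1, 0, -7]` (`N = 27`; Cremona: rank `0`, `#tors = 3`, `∏c_p = 3`, `#Ш_an = 1` — double unit zone) -/

/-- `Δ = -19683` for the anchor model `[0, 0, 1, 0, -7]`. [cite: CremonaAlgorithms1997, Table 1] -/
theorem ua27a1_Δ : (⟨0, 0, 1, 0, -7⟩ : WeierstrassCurve ℤ).Δ = -19683 := by
  decide

/-- `c₄ = 0` for the anchor model `[0, 0, 1, 0, -7]`. [cite: CremonaAlgorithms1997, Table 1] -/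
theorem ua27a1_c₄ : (⟨0, 0, 1, 0, -7⟩ : WeierstrassCurve ℤ).c₄ = 0 := by
  decide

/-- `b₂, b₄, b₆` of the anchor model `[0, 0, 1, 0, -7]`. [cite: SilvermanAEC2009, III.1] -/
theorem ua27a1_b : (⟨0, 0, 1, 0, -7⟩ : WeierstrassCurve ℤ).b₂ = 0 ∧ (⟨0, 0, 1, 0, -7⟩ : WeierstrassCurve ℤ).b₄ = 0 ∧ (⟨0, 0, 1, 0, -7⟩ : WeierstrassCurve ℤ).b₆ = -27 := by
  decide

/-- The anchor `[0, 0, 1, 0, -7]` is an elliptic curve (`Δ ≠ 0`). [cite: CremonaAlgorithms1997, Table 1] -/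
theorem isElliptic_ua27a1 : ((⟨0, 0, 1, 0, -7⟩ : WeierstrassCurve ℤ).baseChange ℚ).IsElliptic := by
  rw [WeierstrassCurve.isElliptic_iff, baseChange_int_Δ, ua27a1_Δ]; norm_num

/-- The anchor model `[0, 0, 1, 0, -7]` is globally minimal: Silverman's criterion at the primes `{3}` of `gcd(Δ, c₄) = 19683`.
[cite: SilvermanAEC2009, VII.1 Remark 1.1] -/
theorem isGloballyMinimal_ua27a1 : ((⟨0, 0, 1, 0, -7⟩ : WeierstrassCurve ℤ).baseChange ℚ).IsGloballyMinimal := by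
  rw [baseChange_int_eq]
  refine X11RankOneCertificates.isGloballyMinimal_of_int_criterion (0) (0) (1) (0) (-7)
    (int_criterion_of_primeFactors_gcd (by decide) ?_)
  have hg : (Int.gcd (X11RankOneCertificates.discOf [0, 0, 1, 0, -7])
      (X11RankOneCertificates.c4Of [0, 0, 1, 0, -7])).primeFactors = {3} := by
    rw [show Int.gcd (X11RankOneCertificates.discOf [0, 0, 1, 0, -7])
      (X11RankOneCertificates.c4Of [0, 0, 1, 0, -7]) = 19683 by decide]
    simp [Nat.primeFactors]
  rw [hg]; decide

/-- `#Ã(𝔽₂) = 3` for the anchor `[0, 0, 1, 0, -7]` (`a₁ = 0`, `a₃ = 1`). [cite: SilvermanAEC2009, V.2 and App. A Prop. 1.1 (c)] -/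
theorem card_F2_ua27a1 :
    Nat.card ((⟨0, 0, 1, 0, -7⟩ : WeierstrassCurve ℤ).map (Int.castRingHom (ZMod 2))).toAffine.Point = 3 := by
  rw [natCard_point_F2_of_a₁_eq_zero_of_a₃_eq_one _ (by decide) (by decide)]
  decide

/-- **The anchor `[0, 0, 1, 0, -7]` is good SUPERSINGULAR at `2` with `a₂ = 0`** (`2 ∤ Δ`, `#Ã(𝔽₂) = 3`).
[cite: SilvermanAEC2009, VII.5 Prop. 5.1(a) and V.2] -/
theorem goodSS_two_ua27a1 [((⟨0, 0, 1, 0, -7⟩ : WeierstrassCurve ℤ).baseChange ℚ).IsGloballyMinimal] :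
    ((⟨0, 0, 1, 0, -7⟩ : WeierstrassCurve ℤ).baseChange ℚ).HasGoodReductionAtPrime 2 ∧ ((⟨0, 0, 1, 0, -7⟩ : WeierstrassCurve ℤ).baseChange ℚ).frobeniusTrace 2 = 0 ∧
      GoodSS ((⟨0, 0, 1, 0, -7⟩ : WeierstrassCurve ℤ).baseChange ℚ) 2 :=
  SSColemanRoad.goodSS_two_baseChange_int_of_card_three _ (by rw [ua27a1_Δ]; decide) card_F2_ua27a1

/-! ### The anchor `ua35a1` = Cremona `35a1` = `[0, 1, 1, 9, 1]` (`N = 35`; Cremona: rank `0`, `#tors = 3`, `∏c_p = 3`, `#Ш_an = 1` — double unit zone) -/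

/-- `Δ = -42875` for the anchor model `[0, 1, 1, 9, 1]`. [cite: CremonaAlgorithms1997, Table 1] -/
theorem ua35a1_Δ : (⟨0, 1, 1, 9, 1⟩ : WeierstrassCurve ℤ).Δ = -42875 := by
  decide

/-- `c₄ = -416` for the anchor model `[0, 1, 1, 9, 1]`. [cite: CremonaAlgorithms1997, Table 1] -/
theorem ua35a1_c₄ : (⟨0, 1, 1, 9, 1⟩ : WeierstrassCurve ℤ).c₄ = -416 := by
  decide

/-- `b₂, b₄, b₆` of the anchor model `[0, 1, 1, 9, 1]`. [cite: SilvermanAEC2009, III.1] -/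
theorem ua35a1_b : (⟨0, 1, 1, 9, 1⟩ : WeierstrassCurve ℤ).b₂ = 4 ∧ (⟨0, 1, 1, 9, 1⟩ : WeierstrassCurve ℤ).b₄ = 18 ∧ (⟨0, 1, 1, 9, 1⟩ : WeierstrassCurve ℤ).b₆ = 5 := by
  decide

/-- The anchor `[0, 1, 1, 9, 1]` is an elliptic curve (`Δ ≠ 0`). [cite: CremonaAlgorithms1997, Table 1] -/
theorem isElliptic_ua35a1 : ((⟨0, 1, 1, 9, 1⟩ : WeierstrassCurve ℤ).baseChange ℚ).IsElliptic := by
  rw [WeierstrassCurve.isElliptic_iff, baseChange_int_Δ, ua35a1_Δ]; norm_num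

/-- The anchor model `[0, 1, 1, 9, 1]` is globally minimal: `gcd(Δ, c₄) = 1`.
[cite: SilvermanAEC2009, VII.1 Remark 1.1] -/
theorem isGloballyMinimal_ua35a1 : ((⟨0, 1, 1, 9, 1⟩ : WeierstrassCurve ℤ).baseChange ℚ).IsGloballyMinimal := by
  exact Instances.isGloballyMinimal_baseChange_int_of_gcd_eq_one (0) (1) (1) (9) (1)
    (by decide)

/-- `#Ã(𝔽₂) = 3` for the anchor `[0, 1, 1, 9, 1]` (`a₁ = 0`, `a₃ = 1`). [cite: SilvermanAEC2009, V.2 and App. A Prop. 1.1 (c)] -/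
theorem card_F2_ua35a1 :
    Nat.card ((⟨0, 1, 1, 9, 1⟩ : WeierstrassCurve ℤ).map (Int.castRingHom (ZMod 2))).toAffine.Point = 3 := by
  rw [natCard_point_F2_of_a₁_eq_zero_of_a₃_eq_one _ (by decide) (by decide)]
  decide

/-- **The anchor `[0, 1, 1, 9, 1]` is good SUPERSINGULAR at `2` with `a₂ = 0`** (`2 ∤ Δ`, `#Ã(𝔽₂) = 3`).
[cite: SilvermanAEC2009, VII.5 Prop. 5.1(a) and V.2] -/
theorem goodSS_two_ua35a1 [((⟨0, 1, 1, 9, 1⟩ : WeierstrassCurve ℤ).baseChange ℚ).IsGloballyMinimal] :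
    ((⟨0, 1, 1, 9, 1⟩ : WeierstrassCurve ℤ).baseChange ℚ).HasGoodReductionAtPrime 2 ∧ ((⟨0, 1, 1, 9, 1⟩ : WeierstrassCurve ℤ).baseChange ℚ).frobeniusTrace 2 = 0 ∧
      GoodSS ((⟨0, 1, 1, 9, 1⟩ : WeierstrassCurve ℤ).baseChange ℚ) 2 :=
  SSColemanRoad.goodSS_two_baseChange_int_of_card_three _ (by rw [ua35a1_Δ]; decide) card_F2_ua35a1

/-! ### The anchor `ua51a1` = Cremona `51a1` = `[0, 1, 1, 1, -1]` (`N = 51`; Cremona: rank `0`, `#tors = 3`, `∏c_p = 3`, `#Ш_an = 1` — double unit zone) -/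

/-- `Δ = -459` for the anchor model `[0, 1, 1, 1, -1]`. [cite: CremonaAlgorithms1997, Table 1] -/
theorem ua51a1_Δ : (⟨0, 1, 1, 1, -1⟩ : WeierstrassCurve ℤ).Δ = -459 := by
  decide

/-- `c₄ = -32` for the anchor model `[0, 1, 1, 1, -1]`. [cite: CremonaAlgorithms1997, Table 1] -/
theorem ua51a1_c₄ : (⟨0, 1, 1, 1, -1⟩ : WeierstrassCurve ℤ).c₄ = -32 := by
  decide

/-- `b₂, b₄, b₆` of the anchor model `[0, 1, 1, 1, -1]`. [cite: SilvermanAEC2009, III.1] -/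
theorem ua51a1_b : (⟨0, 1, 1, 1, -1⟩ : WeierstrassCurve ℤ).b₂ = 4 ∧ (⟨0, 1, 1, 1, -1⟩ : WeierstrassCurve ℤ).b₄ = 2 ∧ (⟨0, 1, 1, 1, -1⟩ : WeierstrassCurve ℤ).b₆ = -3 := by
  decide

/-- The anchor `[0, 1, 1, 1, -1]` is an elliptic curve (`Δ ≠ 0`). [cite: CremonaAlgorithms1997, Table 1] -/
theorem isElliptic_ua51a1 : ((⟨0, 1, 1, 1, -1⟩ : WeierstrassCurve ℤ).baseChange ℚ).IsElliptic := by
  rw [WeierstrassCurve.isElliptic_iff, baseChange_int_Δ, ua51a1_Δ]; norm_num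

/-- The anchor model `[0, 1, 1, 1, -1]` is globally minimal: `gcd(Δ, c₄) = 1`.
[cite: SilvermanAEC2009, VII.1 Remark 1.1] -/
theorem isGloballyMinimal_ua51a1 : ((⟨0, 1, 1, 1, -1⟩ : WeierstrassCurve ℤ).baseChange ℚ).IsGloballyMinimal := by
  exact Instances.isGloballyMinimal_baseChange_int_of_gcd_eq_one (0) (1) (1) (1) (-1)
    (by decide)

/-- `#Ã(𝔽₂) = 3` for the anchor `[0, 1, 1, 1, -1]` (`a₁ = 0`, `a₃ = 1`). [cite: SilvermanAEC2009, V.2 and App. A Prop. 1.1 (c)] -/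
theorem card_F2_ua51a1 :
    Nat.card ((⟨0, 1, 1, 1, -1⟩ : WeierstrassCurve ℤ).map (Int.castRingHom (ZMod 2))).toAffine.Point = 3 := by
  rw [natCard_point_F2_of_a₁_eq_zero_of_a₃_eq_one _ (by decide) (by decide)]
  decide

/-- **The anchor `[0, 1, 1, 1, -1]` is good SUPERSINGULAR at `2` with `a₂ = 0`** (`2 ∤ Δ`, `#Ã(𝔽₂) = 3`).
[cite: SilvermanAEC2009, VII.5 Prop. 5.1(a) and V.2] -/
theorem goodSS_two_ua51a1 [((⟨0, 1, 1, 1, -1⟩ : WeierstrassCurve ℤ).baseChange ℚ).IsGloballyMinimal] :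
    ((⟨0, 1, 1, 1, -1⟩ : WeierstrassCurve ℤ).baseChange ℚ).HasGoodReductionAtPrime 2 ∧ ((⟨0, 1, 1, 1, -1⟩ : WeierstrassCurve ℤ).baseChange ℚ).frobeniusTrace 2 = 0 ∧
      GoodSS ((⟨0, 1, 1, 1, -1⟩ : WeierstrassCurve ℤ).baseChange ℚ) 2 :=
  SSColemanRoad.goodSS_two_baseChange_int_of_card_three _ (by rw [ua51a1_Δ]; decide) card_F2_ua51a1

/-! ### The anchor `ua267a1` = Cremona `267a1` = `[0, 1, 1, -3, 2]` (`N = 267`; Cremona: rank `0`, `#tors = 3`, `∏c_p = 3`, `#Ш_an = 1` — double unit zone) -/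

/-- `Δ = -2403` for the anchor model `[0, 1, 1, -3, 2]`. [cite: CremonaAlgorithms1997, Table 1] -/
theorem ua267a1_Δ : (⟨0, 1, 1, -3, 2⟩ : WeierstrassCurve ℤ).Δ = -2403 := by
  decide

/-- `c₄ = 160` for the anchor model `[0, 1, 1, -3, 2]`. [cite: CremonaAlgorithms1997, Table 1] -/
theorem ua267a1_c₄ : (⟨0, 1, 1, -3, 2⟩ : WeierstrassCurve ℤ).c₄ = 160 := by
  decide

/-- `b₂, b₄, b₆` of the anchor model `[0, 1, 1, -3, 2]`. [cite: SilvermanAEC2009, III.1] -/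
theorem ua267a1_b : (⟨0, 1, 1, -3, 2⟩ : WeierstrassCurve ℤ).b₂ = 4 ∧ (⟨0, 1, 1, -3, 2⟩ : WeierstrassCurve ℤ).b₄ = -6 ∧ (⟨0, 1, 1, -3, 2⟩ : WeierstrassCurve ℤ).b₆ = 9 := by
  decide

/-- The anchor `[0, 1, 1, -3, 2]` is an elliptic curve (`Δ ≠ 0`). [cite: CremonaAlgorithms1997, Table 1] -/
theorem isElliptic_ua267a1 : ((⟨0, 1, 1, -3, 2⟩ : WeierstrassCurve ℤ).baseChange ℚ).IsElliptic := by
  rw [WeierstrassCurve.isElliptic_iff, baseChange_int_Δ, ua267a1_Δ]; norm_num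

/-- The anchor model `[0, 1, 1, -3, 2]` is globally minimal: `gcd(Δ, c₄) = 1`.
[cite: SilvermanAEC2009, VII.1 Remark 1.1] -/
theorem isGloballyMinimal_ua267a1 : ((⟨0, 1, 1, -3, 2⟩ : WeierstrassCurve ℤ).baseChange ℚ).IsGloballyMinimal := by
  exact Instances.isGloballyMinimal_baseChange_int_of_gcd_eq_one (0) (1) (1) (-3) (2)
    (by decide)

/-- `#Ã(𝔽₂) = 3` for the anchor `[0, 1, 1, -3, 2]` (`a₁ = 0`, `a₃ = 1`). [cite: SilvermanAEC2009, V.2 and App. A Prop. 1.1 (c)] -/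
theorem card_F2_ua267a1 :
    Nat.card ((⟨0, 1, 1, -3, 2⟩ : WeierstrassCurve ℤ).map (Int.castRingHom (ZMod 2))).toAffine.Point = 3 := by
  rw [natCard_point_F2_of_a₁_eq_zero_of_a₃_eq_one _ (by decide) (by decide)]
  decide

/-- **The anchor `[0, 1, 1, -3, 2]` is good SUPERSINGULAR at `2` with `a₂ = 0`** (`2 ∤ Δ`, `#Ã(𝔽₂) = 3`).
[cite: SilvermanAEC2009, VII.5 Prop. 5.1(a) and V.2] -/
theorem goodSS_two_ua267a1 [((⟨0, 1, 1, -3, 2⟩ : WeierstrassCurve ℤ).baseChange ℚ).IsGloballyMinimal] :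
    ((⟨0, 1, 1, -3, 2⟩ : WeierstrassCurve ℤ).baseChange ℚ).HasGoodReductionAtPrime 2 ∧ ((⟨0, 1, 1, -3, 2⟩ : WeierstrassCurve ℤ).baseChange ℚ).frobeniusTrace 2 = 0 ∧
      GoodSS ((⟨0, 1, 1, -3, 2⟩ : WeierstrassCurve ℤ).baseChange ℚ) 2 :=
  SSColemanRoad.goodSS_two_baseChange_int_of_card_three _ (by rw [ua267a1_Δ]; decide) card_F2_ua267a1

/-! ### The anchor `ua555a1` = Cremona `555a1` = `[0, 1, 1, -1, -29]` (`N = 555`; Cremona: rank `0`, `#tors = 1`, `∏c_p = 1`, `#Ш_an = 1` — double unit zone) -/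

/-- `Δ = -346875` for the anchor model `[0, 1, 1, -1, -29]`. [cite: CremonaAlgorithms1997, Table 1] -/
theorem ua555a1_Δ : (⟨0, 1, 1, -1, -29⟩ : WeierstrassCurve ℤ).Δ = -346875 := by
  decide

/-- `c₄ = 64` for the anchor model `[0, 1, 1, -1, -29]`. [cite: CremonaAlgorithms1997, Table 1] -/
theorem ua555a1_c₄ : (⟨0, 1, 1, -1, -29⟩ : WeierstrassCurve ℤ).c₄ = 64 := by
  decide

/-- `b₂, b₄, b₆` of the anchor model `[0, 1, 1, -1, -29]`. [cite: SilvermanAEC2009, III.1] -/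
theorem ua555a1_b : (⟨0, 1, 1, -1, -29⟩ : WeierstrassCurve ℤ).b₂ = 4 ∧ (⟨0, 1, 1, -1, -29⟩ : WeierstrassCurve ℤ).b₄ = -2 ∧ (⟨0, 1, 1, -1, -29⟩ : WeierstrassCurve ℤ).b₆ = -115 := by
  decide

/-- The anchor `[0, 1, 1, -1, -29]` is an elliptic curve (`Δ ≠ 0`). [cite: CremonaAlgorithms1997, Table 1] -/
theorem isElliptic_ua555a1 : ((⟨0, 1, 1, -1, -29⟩ : WeierstrassCurve ℤ).baseChange ℚ).IsElliptic := by
  rw [WeierstrassCurve.isElliptic_iff, baseChange_int_Δ, ua555a1_Δ]; norm_num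

/-- The anchor model `[0, 1, 1, -1, -29]` is globally minimal: `gcd(Δ, c₄) = 1`.
[cite: SilvermanAEC2009, VII.1 Remark 1.1] -/
theorem isGloballyMinimal_ua555a1 : ((⟨0, 1, 1, -1, -29⟩ : WeierstrassCurve ℤ).baseChange ℚ).IsGloballyMinimal := by
  exact Instances.isGloballyMinimal_baseChange_int_of_gcd_eq_one (0) (1) (1) (-1) (-29)
    (by decide)

/-- `#Ã(𝔽₂) = 3` for the anchor `[0, 1, 1, -1, -29]` (`a₁ = 0`, `a₃ = 1`). [cite: SilvermanAEC2009, V.2 and App. A Prop. 1.1 (c)] -/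
theorem card_F2_ua555a1 :
    Nat.card ((⟨0, 1, 1, -1, -29⟩ : WeierstrassCurve ℤ).map (Int.castRingHom (ZMod 2))).toAffine.Point = 3 := by
  rw [natCard_point_F2_of_a₁_eq_zero_of_a₃_eq_one _ (by decide) (by decide)]
  decide

/-- **The anchor `[0, 1, 1, -1, -29]` is good SUPERSINGULAR at `2` with `a₂ = 0`** (`2 ∤ Δ`, `#Ã(𝔽₂) = 3`).
[cite: SilvermanAEC2009, VII.5 Prop. 5.1(a) and V.2] -/
theorem goodSS_two_ua555a1 [((⟨0, 1, 1, -1, -29⟩ : WeierstrassCurve ℤ).baseChange ℚ).IsGloballyMinimal] :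
    ((⟨0, 1, 1, -1, -29⟩ : WeierstrassCurve ℤ).baseChange ℚ).HasGoodReductionAtPrime 2 ∧ ((⟨0, 1, 1, -1, -29⟩ : WeierstrassCurve ℤ).baseChange ℚ).frobeniusTrace 2 = 0 ∧
      GoodSS ((⟨0, 1, 1, -1, -29⟩ : WeierstrassCurve ℤ).baseChange ℚ) 2 :=
  SSColemanRoad.goodSS_two_baseChange_int_of_card_three _ (by rw [ua555a1_Δ]; decide) card_F2_ua555a1

/-! ### The anchor `ua627a1` = Cremona `627a1` = `[0, 1, 1, -1, -2]` (`N = 627`; Cremona: rank `0`, `#tors = 1`, `∏c_p = 1`, `#Ш_an = 1` — double unit zone) -/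

/-- `Δ = -627` for the anchor model `[0, 1, 1, -1, -2]`. [cite: CremonaAlgorithms1997, Table 1] -/
theorem ua627a1_Δ : (⟨0, 1, 1, -1, -2⟩ : WeierstrassCurve ℤ).Δ = -627 := by
  decide

/-- `c₄ = 64` for the anchor model `[0, 1, 1, -1, -2]`. [cite: CremonaAlgorithms1997, Table 1] -/
theorem ua627a1_c₄ : (⟨0, 1, 1, -1, -2⟩ : WeierstrassCurve ℤ).c₄ = 64 := by
  decide

/-- `b₂, b₄, b₆` of the anchor model `[0, 1, 1, -1, -2]`. [cite: SilvermanAEC2009, III.1] -/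
theorem ua627a1_b : (⟨0, 1, 1, -1, -2⟩ : WeierstrassCurve ℤ).b₂ = 4 ∧ (⟨0, 1, 1, -1, -2⟩ : WeierstrassCurve ℤ).b₄ = -2 ∧ (⟨0, 1, 1, -1, -2⟩ : WeierstrassCurve ℤ).b₆ = -7 := by
  decide

/-- The anchor `[0, 1, 1, -1, -2]` is an elliptic curve (`Δ ≠ 0`). [cite: CremonaAlgorithms1997, Table 1] -/
theorem isElliptic_ua627a1 : ((⟨0, 1, 1, -1, -2⟩ : WeierstrassCurve ℤ).baseChange ℚ).IsElliptic := by
  rw [WeierstrassCurve.isElliptic_iff, baseChange_int_Δ, ua627a1_Δ]; norm_num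

/-- The anchor model `[0, 1, 1, -1, -2]` is globally minimal: `gcd(Δ, c₄) = 1`.
[cite: SilvermanAEC2009, VII.1 Remark 1.1] -/
theorem isGloballyMinimal_ua627a1 : ((⟨0, 1, 1, -1, -2⟩ : WeierstrassCurve ℤ).baseChange ℚ).IsGloballyMinimal := by
  exact Instances.isGloballyMinimal_baseChange_int_of_gcd_eq_one (0) (1) (1) (-1) (-2)
    (by decide)

/-- `#Ã(𝔽₂) = 3` for the anchor `[0, 1, 1, -1, -2]` (`a₁ = 0`, `a₃ = 1`). [cite: SilvermanAEC2009, V.2 and App. A Prop. 1.1 (c)] -/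
theorem card_F2_ua627a1 :
    Nat.card ((⟨0, 1, 1, -1, -2⟩ : WeierstrassCurve ℤ).map (Int.castRingHom (ZMod 2))).toAffine.Point = 3 := by
  rw [natCard_point_F2_of_a₁_eq_zero_of_a₃_eq_one _ (by decide) (by decide)]
  decide

/-- **The anchor `[0, 1, 1, -1, -2]` is good SUPERSINGULAR at `2` with `a₂ = 0`** (`2 ∤ Δ`, `#Ã(𝔽₂) = 3`).
[cite: SilvermanAEC2009, VII.5 Prop. 5.1(a) and V.2] -/
theorem goodSS_two_ua627a1 [((⟨0, 1, 1, -1, -2⟩ : WeierstrassCurve ℤ).baseChange ℚ).IsGloballyMinimal] :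
    ((⟨0, 1, 1, -1, -2⟩ : WeierstrassCurve ℤ).baseChange ℚ).HasGoodReductionAtPrime 2 ∧ ((⟨0, 1, 1, -1, -2⟩ : WeierstrassCurve ℤ).baseChange ℚ).frobeniusTrace 2 = 0 ∧
      GoodSS ((⟨0, 1, 1, -1, -2⟩ : WeierstrassCurve ℤ).baseChange ℚ) 2 :=
  SSColemanRoad.goodSS_two_baseChange_int_of_card_three _ (by rw [ua627a1_Δ]; decide) card_F2_ua627a1

end SSUnitAnchor
end Summit.BirchSwinnertonDyer.BirchSwinnertonDyer.Theorems

end
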